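import Summits.KontsevichZagierPeriods.KontsevichZagierPeriods.Theorems.LiftingCriteriaCubeNashNormalFormTame
import Literature.NumberTheory.Transcendental.JungChartPackage
import Literature.NumberTheory.Transcendental.JungShearPreparation
import Literature.NumberTheory.Transcendental.DyadicRamifiedCharts
import Literature.NumberTheory.Transcendental.CubeChartBasics
import Literature.Algebra.Polynomial.MidpointResultant
import Literature.NumberTheory.Transcendental.SemialgebraicMaps
import Mathlib.RingTheory.Polynomial.Resultant.Basic
import Mathlib.Analysis.Analytic.Basic
import Mathlib.Analysis.Calculus.FDeriv.Analytic
import Mathlib.MeasureTheory.Measure.Lebesgue.Basic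

/-!
# Crux `CubeNashNormalForm` (stmt-KontsevichZagierPeriods-3574), line `Sketch` — stub `stub_jungPrepare`

The lead's stub (continuation c1): global assembly of Jung's projection step `E(d) ∧ AJ(d) ∧ DIV(d)
⇒ PREP(d)` from the landed one-chart package
`Literature.NumberTheory.Transcendental.JungPreparation.exists_chart_package` over the base charts of
`E(d)` (applied to a box containing the sheared base and the discriminant of the midpoint-augmented
monic form) and the `2ᵈ` dyadic corners.
-/

noncomputable section

open Set MeasureTheory Polynomial
open Literature.ModelTheory.ExponentialFields (IsSemialgebraic)
open Literature.NumberTheory.Transcendental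
open Literature.NumberTheory.Transcendental.JungPreparation

namespace Summit.KontsevichZagierPeriods.SymplecticScissors.CubeNashNormalFormJungPrepare

variable {d : ℕ}

/-- **Midpoint augmentation with non-zero discriminant.** For a monic `Rh ∈ ℚ[x][T]` there is a
monic `P ∈ ℚ[x][T]` with `Res(P, P') ≠ 0` such that a rational multiple of the midpoint resultant
`M = Res_S(Rh(S), Rh(2T − S))` divides a power of `P` (`P` = monic square-free part of
`2^{-D²} M`). [folklore] -/
theorem exists_midpoint_squarefree {Rh : (MvPolynomial (Fin d) ℚ)[X]} (hRh : Rh.Monic) :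
    ∃ (P M : (MvPolynomial (Fin d) ℚ)[X]) (κM : ℚ) (mM : ℕ), P.Monic ∧
      M = (Rh.map C).resultant ((Rh.map C).comp (C (2 * X) - X)) Rh.natDegree Rh.natDegree ∧
      C (MvPolynomial.C κM) * M ∣ P ^ mM ∧
      P.resultant (derivative P) P.natDegree (P.natDegree - 1) ≠ 0 := by
  set M := (Rh.map C).resultant ((Rh.map C).comp (C (2 * X) - X)) Rh.natDegree Rh.natDegree with hM
  obtain ⟨-, hlc⟩ := Literature.Algebra.Polynomial.natDegree_midpointResultant hRh hM
  set κM : ℚ := ((2 : ℚ) ^ (Rh.natDegree ^ 2))⁻¹ with hκM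
  have hmonic : (C (MvPolynomial.C κM) * M).Monic := by
    refine monic_C_mul_of_mul_leadingCoeff_eq_one ?_
    rw [hlc, hκM]
    have h2 : (2 : MvPolynomial (Fin d) ℚ) ^ (Rh.natDegree ^ 2) =
        MvPolynomial.C ((2 : ℚ) ^ (Rh.natDegree ^ 2)) := by
      rw [MvPolynomial.C_pow, map_ofNat]
    rw [h2, ← MvPolynomial.C_mul, inv_mul_cancel₀ (pow_ne_zero _ two_ne_zero), MvPolynomial.C_1]
  obtain ⟨P, hP, -, ⟨m, hm⟩, hres⟩ :=
    Literature.Algebra.Polynomial.exists_monic_squarefree_part _ hmonic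
  exact ⟨P, M, κM, m, hP, rfl, hm, hres⟩

/-- The open box `(−R, R)ᵈ` is `ℚ`-semialgebraic. [folklore] -/
theorem isSemialgebraic_openBox (R : ℕ) :
    IsSemialgebraic ℚ {x : Fin d → ℝ | ∀ j, x j ∈ Set.Ioo (-(R : ℝ)) R} := by
  have h : {x : Fin d → ℝ | ∀ j, x j ∈ Set.Ioo (-(R : ℝ)) R} =
      ⋂ j ∈ (Finset.univ : Finset (Fin d)),
        ({x | 0 < MvPolynomial.aeval x (MvPolynomial.X j + MvPolynomial.C (R : ℚ) :
            MvPolynomial (Fin d) ℚ)} ∩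
          {x | 0 < MvPolynomial.aeval x (MvPolynomial.C (R : ℚ) - MvPolynomial.X j :
            MvPolynomial (Fin d) ℚ)}) := by
    ext x
    simp only [Set.mem_Ioo, Set.mem_setOf_eq, Finset.mem_univ, Set.iInter_true, Set.mem_iInter,
      Set.mem_inter_iff, map_add, map_sub, MvPolynomial.aeval_X, MvPolynomial.aeval_C, eq_ratCast,
      Rat.cast_natCast, sub_pos]
    exact forall_congr' fun j => and_congr_left fun _ => by constructor <;> intro h <;> linarith
  rw [h]
  exact IsSemialgebraic.biInter _ _ fun j _ =>
    (Literature.ModelTheory.ExponentialFields.isSemialgebraic_setOf_eval_pos _).inter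
      (Literature.ModelTheory.ExponentialFields.isSemialgebraic_setOf_eval_pos _)

/-- **Stub S3 `stub_jungPrepare` (Jung's projection step, XL).** From cube-monomialization `E(d)` of
the base, Abhyankar–Jung `AJ(d)` and the divisor lemma `DIV(d)`: every bounded `ℚ`-semialgebraic
`B ⊆ ℝᵈ⁺¹` is a.e. the disjoint union of open-cube images of FORMAT slab charts
`(s, w) ↦ (φ(s), w_k(s) + w·(w_{k+1} − w_k)(s))` along which every `Qⱼ` is in binomial product form
`PREP(d)`. Steps: cylindrical decomposition adapted to `B` and the `Qⱼ`
(`exists_isCylindricalDecomposition_forall_sign_eq`), merge bands across non-root sections; `ℚ`-shear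
`t ↦ t + c·x` making `R = rad ∏ Qⱼ` monic in `t`; midpoint augmentation
`R⁺ = rad Res_s(R(x,s), R(x,2t−s))`; `E(d)` on each bounded base cell for `disc_t R⁺` and the leading
coefficients; dyadic localisation `xᵢ = yᵢ/2`, `1 − yᵢ/2` and `AJ(d)`; real walls = real-valued roots of
`R⁺` (ordered, analytic near the closed cube); `DIV(d)`: wall differences and squared imaginary parts
are cube-monomial · unit; factor `Qⱼ(φ(s), w_k + w·gap) = c_j(φ(s)) ∏ (t − ρ)`.
[Jung 1908; Kollár 2007, §2.3; Kiyek–Vicente 2004, Rem. V.4.4; Basu–Pollack–Roy 2006, Thm. 5.6] -/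
theorem stub_jungPrepare : ∀ d : ℕ, 1 ≤ d → (∀ (B : Set (Fin d → ℝ)), IsSemialgebraic ℚ B → Bornology.IsBounded B → ∀ (k : ℕ) (Q : Fin k → MvPolynomial (Fin d) ℚ), (∀ j, Q j ≠ 0) → ∃ (N : ℕ) (Φ : Fin N → (Fin d → ℝ) → (Fin d → ℝ)), (∀ i, (AnalyticOnNhd ℝ (Φ i) (Set.pi Set.univ (fun _ : Fin d => Set.Icc (0:ℝ) 1)) ∧ IsSemialgebraicMapOn ℚ (Set.pi Set.univ (fun _ : Fin d => Set.Ioo (0:ℝ) 1)) (Φ i) ∧ Set.InjOn (Φ i) (Set.pi Set.univ (fun _ : Fin d => Set.Ioo (0:ℝ) 1)) ∧ ∀ x ∈ Set.pi Set.univ (fun _ : Fin d => Set.Ioo (0:ℝ) 1), (fderiv ℝ (Φ i) x).det ≠ 0)) ∧ (∀ i, Φ i '' Set.pi Set.univ (fun _ : Fin d => Set.Ioo (0:ℝ) 1) ⊆ B) ∧ Pairwise (fun i i' => Disjoint (Φ i '' Set.pi Set.univ (fun _ : Fin d => Set.Ioo (0:ℝ) 1)) (Φ i' '' Set.pi Set.univ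 (fun _ : Fin d => Set.Ioo (0:ℝ) 1))) ∧ MeasureTheory.volume (B \ ⋃ i, Φ i '' Set.pi Set.univ (fun _ : Fin d => Set.Ioo (0:ℝ) 1)) = 0 ∧ ∀ i j, (∃ U : Set (Fin d → ℝ), IsOpen U ∧ Set.pi Set.univ (fun _ : Fin d => Set.Icc (0:ℝ) 1) ⊆ U ∧ ∃ (a b : Fin d → ℕ) (e : (Fin d → ℝ) → ℝ), AnalyticOnNhd ℝ e U ∧ (∀ x ∈ U, e x ≠ 0) ∧ ∀ x ∈ U, (fun x => MvPolynomial.aeval (Φ i x) (Q j)) x = (∏ i, x i ^ a i * (1 - x i) ^ b i) * e x)) → (∀ (n : ℕ) (U : Set (Fin d → ℝ)), IsOpen U → Set.pi Set.univ (fun _ : Fin d => Set.Icc (0:ℝ) 1) ⊆ U → ∀ (a : Fin n → (Fin d → ℝ) → ℝ) (α : Fin d → ℕ) (e : (Fin d → ℝ) → ℝ), (∀ k, AnalyticOnNhd ℝ (a k) U) → AnalyticOnNhd ℝ e U → (∀ x ∈ U, e x ≠ 0) → (∀ x ∈ U, Polynomial.resultant (Polynomial.X ^ n + ∑ k : Fin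 n, Polynomial.C (a k (x)) * Polynomial.X ^ (k : ℕ)) (Polynomial.derivative (Polynomial.X ^ n + ∑ k : Fin n, Polynomial.C (a k (x)) * Polynomial.X ^ (k : ℕ))) = (∏ i, x i ^ α i) * e x) → ∃ N : ℕ, 0 < N ∧ ∃ V : Set (Fin d → ℝ), IsOpen V ∧ Set.pi Set.univ (fun _ : Fin d => Set.Icc (0:ℝ) 1) ⊆ V ∧ (∀ σ ∈ V, (fun i => σ i ^ N) ∈ U) ∧ ∃ ζ : Fin n → (Fin d → ℝ) → ℂ, (∀ l, AnalyticOnNhd ℝ (ζ l) V) ∧ ∀ σ ∈ V, ((Polynomial.X ^ n + ∑ k : Fin n, Polynomial.C (a k (fun i => σ i ^ N)) * Polynomial.X ^ (k : ℕ))).map (algebraMap ℝ ℂ) = ∏ l, (Polynomial.X - Polynomial.C (ζ l σ))) → (∀ (U : Set (Fin d → ℝ)), IsOpen U → Set.pi Set.univ (fun _ : Fin d => Set.Icc (0:ℝ) 1) ⊆ U → ∀ (f g e : (Fin d → ℝ) → ℂ) (a : Fin d → ℕ), AnalyticOnNhd ℝ f U → AnalyticOnNhd ℝ g U → AnalyticOnNhd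 ℝ e U → (∀ x ∈ U, e x ≠ 0) → (∀ x ∈ U, f x * g x = (∏ i, ((x i : ℝ) : ℂ) ^ a i) * e x) → ∃ (b : Fin d → ℕ) (V : Set (Fin d → ℝ)) (u : (Fin d → ℝ) → ℂ), IsOpen V ∧ Set.pi Set.univ (fun _ : Fin d => Set.Icc (0:ℝ) 1) ⊆ V ∧ V ⊆ U ∧ AnalyticOnNhd ℝ u V ∧ (∀ x ∈ V, u x ≠ 0) ∧ (∀ i, b i ≤ a i) ∧ ∀ x ∈ V, f x = (∏ i, ((x i : ℝ) : ℂ) ^ b i) * u x) → (∀ (B : Set (Fin (d + 1) → ℝ)), IsSemialgebraic ℚ B → Bornology.IsBounded B → ∀ (k : ℕ) (Q : Fin k → MvPolynomial (Fin (d + 1)) ℚ), (∀ j, Q j ≠ 0) → ∃ (N : ℕ) (Φ : Fin N → (Fin (d + 1) → ℝ) → (Fin (d + 1) → ℝ)), (∀ i, (AnalyticOnNhd ℝ (Φ i) (Set.pi Set.univ (fun _ : Fin (d + 1) => Set.Icc (0:ℝ) 1)) ∧ IsSemialgebraicMapOn ℚ (Set.pi Set.univ (fun _ : Fin (d + 1)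 => Set.Ioo (0:ℝ) 1)) (Φ i) ∧ Set.InjOn (Φ i) (Set.pi Set.univ (fun _ : Fin (d + 1) => Set.Ioo (0:ℝ) 1)) ∧ ∀ x ∈ Set.pi Set.univ (fun _ : Fin (d + 1) => Set.Ioo (0:ℝ) 1), (fderiv ℝ (Φ i) x).det ≠ 0)) ∧ (∀ i, Φ i '' Set.pi Set.univ (fun _ : Fin (d + 1) => Set.Ioo (0:ℝ) 1) ⊆ B) ∧ Pairwise (fun i i' => Disjoint (Φ i '' Set.pi Set.univ (fun _ : Fin (d + 1) => Set.Ioo (0:ℝ) 1)) (Φ i' '' Set.pi Set.univ (fun _ : Fin (d + 1) => Set.Ioo (0:ℝ) 1))) ∧ MeasureTheory.volume (B \ ⋃ i, Φ i '' Set.pi Set.univ (fun _ : Fin (d + 1) => Set.Ioo (0:ℝ) 1)) = 0 ∧ ∀ i j, (∃ U : Set (Fin (d + 1) → ℝ), IsOpen U ∧ Set.pi Set.univ (fun _ : Fin (d + 1) => Set.Icc (0:ℝ) 1) ⊆ U ∧ ∃ (a₀ b₀ : Fin (d + 1) → ℕ) (e₀ : (Fin (d + 1) → ℝ) → ℝ)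 (L₁ L₂ : ℕ) (m₁ : Fin L₁ → ℕ) (a₁ b₁ a₂ b₂ : Fin L₁ → Fin (d + 1) → ℕ) (e₁ e₂ : Fin L₁ → (Fin (d + 1) → ℝ) → ℝ) (m₂ : Fin L₂ → ℕ) (a₃ b₃ a₄ b₄ a₅ b₅ : Fin L₂ → Fin (d + 1) → ℕ) (e₃ e₄ e₅ : Fin L₂ → (Fin (d + 1) → ℝ) → ℝ), AnalyticOnNhd ℝ e₀ U ∧ (∀ x ∈ U, e₀ x ≠ 0) ∧ (∀ l, AnalyticOnNhd ℝ (e₁ l) U ∧ AnalyticOnNhd ℝ (e₂ l) U ∧ ∀ x ∈ U, 0 < e₁ l x ∧ 0 < e₂ l x) ∧ (∀ l, AnalyticOnNhd ℝ (e₃ l) U ∧ AnalyticOnNhd ℝ (e₄ l) U ∧ AnalyticOnNhd ℝ (e₅ l) U ∧ ∀ x ∈ U, 0 < e₃ l x ∧ 0 < e₄ l x ∧ 0 < e₅ l x) ∧ ∀ x ∈ U, (fun x => MvPolynomial.aeval (Φ i x) (Q j)) x = (∏ i, x i ^ a₀ i * (1 - x i) ^ b₀ i) * e₀ x * (∏ l,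 ((∏ i, x i ^ a₁ l i * (1 - x i) ^ b₁ l i) * e₁ l x + (∏ i, x i ^ a₂ l i * (1 - x i) ^ b₂ l i) * e₂ l x) ^ m₁ l) * ∏ l, (((∏ i, x i ^ a₃ l i * (1 - x i) ^ b₃ l i) * e₃ l x + (∏ i, x i ^ a₄ l i * (1 - x i) ^ b₄ l i) * e₄ l x) ^ 2 + (∏ i, x i ^ a₅ l i * (1 - x i) ^ b₅ l i) * e₅ l x) ^ m₂ l)) := by
  classical
  intro d _ hE hAJ hDIV B hB hBb k Q hQ
  -- ### algebraic preparation: sign presentation, shear, monic forms, midpoint augmentation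
  obtain ⟨Ps, T, v, Rh, Qh, κ, Ph, κ', hBT, hRh, hQh, hPh, hQeval, hPeval⟩ := exists_shear_data B hB Q hQ
  obtain ⟨P, M, κM, mM, hP, hM, hMP, hres⟩ := exists_midpoint_squarefree hRh
  -- ### the shear
  set Sh : (Fin (d + 1) → ℝ) → (Fin (d + 1) → ℝ) := fun z =>
    Fin.snoc (fun i : Fin d => z (Fin.castSucc i) + algebraMap ℚ ℝ (v i) * z (Fin.last d))
      (z (Fin.last d)) with hShdef
  have hSh : ∀ z, Sh z = Fin.snoc (fun i : Fin d => z (Fin.castSucc i) +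
      algebraMap ℚ ℝ (v i) * z (Fin.last d)) (z (Fin.last d)) := fun z => rfl
  obtain ⟨TSh, hTSh⟩ := exists_shear_continuousLinearEquiv v
  have hShT : ∀ z, Sh z = TSh z := fun z => (hTSh z).symm
  have hShinj : Function.Injective Sh := fun z z' h =>
    TSh.injective (by rw [← hShT, ← hShT]; exact h)
  have hpre : {z | Sh z ∈ B} = TSh.symm '' B := by
    ext z
    constructor
    · intro hz
      exact ⟨TSh z, by rw [← hShT]; exact hz, TSh.symm_apply_apply z⟩
    · rintro ⟨y, hy, rfl⟩
      show Sh (TSh.symm y) ∈ B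
      rw [hShT, TSh.apply_symm_apply]
      exact hy
  have hbdd : Bornology.IsBounded {z | Sh z ∈ B} := by
    rw [hpre]
    exact TSh.symm.lipschitz.isBounded_image hBb
  -- ### the base box
  obtain ⟨Cb, hCb⟩ := hbdd.exists_norm_le
  set R : ℕ := ⌈Cb⌉₊ + 1 with hR
  have hCR : Cb < R := by
    rw [hR]
    push_cast
    exact (Nat.le_ceil Cb).trans_lt (lt_add_one _)
  set B₀ : Set (Fin d → ℝ) := {x | ∀ j, x j ∈ Set.Ioo (-(R : ℝ)) R} with hB₀
  have hB₀s : IsSemialgebraic ℚ B₀ := isSemialgebraic_openBox R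
  have hB₀b : Bornology.IsBounded B₀ := by
    refine (Metric.isBounded_closedBall (x := (0 : Fin d → ℝ)) (r := R)).subset fun x hx => ?_
    rw [Metric.mem_closedBall, dist_zero_right, pi_norm_le_iff_of_nonneg (Nat.cast_nonneg R)]
    intro j
    rw [Real.norm_eq_abs, abs_le]
    exact ⟨(hx j).1.le, (hx j).2.le⟩
  have hinitB₀ : ∀ z, Sh z ∈ B → Fin.init z ∈ B₀ := by
    intro z hz j
    have h1 : ‖z‖ ≤ Cb := hCb z hz
    have h2 : ‖z (Fin.castSucc j)‖ ≤ ‖z‖ := norm_le_pi_norm z _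
    rw [Real.norm_eq_abs] at h2
    have h3 := abs_le.1 (h2.trans h1)
    change -(R : ℝ) < z (Fin.castSucc j) ∧ z (Fin.castSucc j) < R
    exact ⟨by linarith [h3.1], by linarith [h3.2]⟩
  -- ### base charts from `E(d)` applied to the box and the discriminant
  obtain ⟨N₀, φ, hφF, hφB₀, hφdisj, hφnull, hφmono⟩ := hE B₀ hB₀s hB₀b 1
    (fun _ => P.resultant (derivative P) P.natDegree (P.natDegree - 1)) (fun _ => hres)
  have hφmono' : ∀ i : Fin N₀, ∃ U : Set (Fin d → ℝ), IsOpen U ∧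
      Set.pi Set.univ (fun _ : Fin d => Set.Icc (0:ℝ) 1) ⊆ U ∧
      ∃ (a b : Fin d → ℕ) (e : (Fin d → ℝ) → ℝ), AnalyticOnNhd ℝ e U ∧ (∀ x ∈ U, e x ≠ 0) ∧
        ∀ x ∈ U, MvPolynomial.aeval (φ i x) (P.resultant (derivative P) P.natDegree (P.natDegree - 1)) =
          (∏ i, x i ^ a i * (1 - x i) ^ b i) * e x := fun i => hφmono i 0
  choose U₀ hU₀ hKU₀ a b e₀ he₀ he₀0 hDφ using hφmono'
  -- ### the chart packages, one per base chart and dyadic corner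
  have hpkg := fun (i : Fin N₀) (c : Fin d → Bool) =>
    exists_chart_package hAJ hDIV Q hBT v Sh hSh hbdd hRh hP rfl hM hMP rfl Qh
      (fun j => ⟨(hQh j).2.1, (hQh j).2.2⟩) κ (fun j => (hQh j).1) hQeval Ph κ' hPh hPeval (φ i)
      (hφF i).1 (hφF i).2.1 (hφF i).2.2.1 (hφF i).2.2.2 (hU₀ i) (hKU₀ i) (a i) (b i) (he₀ i) (he₀0 i)
      (hDφ i) c
  choose Nn χ Nc Ψ Nz hNn hχ _hχinj hΨF hΨB hΨdisj hΨcyl hNz0 hcover hfactor using hpkg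
  -- ### the base pieces `χ_{i,c}((0,1)ᵈ) = φ_i(ψ_c((0,1)ᵈ))` are pairwise disjoint
  have hχimg : ∀ i c, χ i c '' Set.pi Set.univ (fun _ : Fin d => Set.Ioo (0:ℝ) 1) =
      φ i '' ((fun (y : Fin d → ℝ) (l : Fin d) => if c l then 1 - y l / 2 else y l / 2) ''
        Set.pi Set.univ (fun _ : Fin d => Set.Ioo (0:ℝ) 1)) := fun i c =>
    (dyadicRamified_format c (Nn i c) (φ i)
      (fun (y : Fin d → ℝ) (l : Fin d) => if c l then 1 - y l / 2 else y l / 2)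
      (fun (σ : Fin d → ℝ) (l : Fin d) => σ l ^ Nn i c) (χ i c) (hNn i c) (fun _ _ => rfl)
      (fun _ _ => rfl) (fun σ => hχ i c σ) (hφF i).1 (hφF i).2.1 (hφF i).2.2.1 (hφF i).2.2.2).2
  have hbase_disj : ∀ p p' : Fin N₀ × (Fin d → Bool), p ≠ p' →
      Disjoint (χ p.1 p.2 '' Set.pi Set.univ (fun _ : Fin d => Set.Ioo (0:ℝ) 1))
        (χ p'.1 p'.2 '' Set.pi Set.univ (fun _ : Fin d => Set.Ioo (0:ℝ) 1)) := by
    rintro ⟨i, c⟩ ⟨i', c'⟩ hne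
    simp only
    rw [hχimg, hχimg]
    by_cases hii' : i = i'
    · subst hii'
      have hcc' : c ≠ c' := fun h => hne (by rw [h])
      exact disjoint_image_dyadicRamified (φ i) hcc' (fun _ _ => rfl) (fun _ _ => rfl) (hφF i).2.2.1
    · refine Set.disjoint_of_subset ?_ ?_ (hφdisj hii')
      · exact Set.image_mono
          (dyadic_mapsTo_Ioo c (fun (y : Fin d → ℝ) (l : Fin d) => if c l then 1 - y l / 2 else y l / 2)
            (fun _ _ => rfl)).image_subset
      · exact Set.image_mono
          (dyadic_mapsTo_Ioo c' (fun (y : Fin d → ℝ) (l : Fin d) => if c' l then 1 - y l / 2 else y l / 2)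
            (fun _ _ => rfl)).image_subset
  -- ### the global atlas, indexed by `(i, c, a)`
  have hdisj' : Pairwise fun q q' : (p : Fin N₀ × (Fin d → Bool)) × Fin (Nc p.1 p.2) =>
      Disjoint (Ψ q.1.1 q.1.2 q.2 '' Set.pi Set.univ (fun _ : Fin (d + 1) => Set.Ioo (0:ℝ) 1))
        (Ψ q'.1.1 q'.1.2 q'.2 '' Set.pi Set.univ (fun _ : Fin (d + 1) => Set.Ioo (0:ℝ) 1)) := by
    intro q q' hne
    by_cases hp : q.1 = q'.1
    · obtain ⟨p, u⟩ := q
      obtain ⟨p', u'⟩ := q'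
      simp only at hp
      subst hp
      have huu' : u ≠ u' := fun h => hne (by subst h; rfl)
      exact hΨdisj p.1 p.2 huu'
    · refine Set.disjoint_of_subset (hΨcyl _ _ _) (hΨcyl _ _ _) ?_
      refine Set.disjoint_image_of_injective hShinj ?_
      exact Set.disjoint_left.2 fun u hu hu' => Set.disjoint_left.1 (hbase_disj _ _ hp) hu hu'
  -- ### the null remainder
  set NB : Set (Fin d → ℝ) := (B₀ \ ⋃ i, φ i '' Set.pi Set.univ (fun _ : Fin d => Set.Ioo (0:ℝ) 1)) ∪
    ⋃ i, (φ i '' Set.pi Set.univ (fun _ : Fin d => Set.Ioo (0:ℝ) 1) \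
      ⋃ c : Fin d → Bool, φ i '' ((fun (y : Fin d → ℝ) (l : Fin d) => if c l then 1 - y l / 2 else y l / 2) ''
        Set.pi Set.univ (fun _ : Fin d => Set.Ioo (0:ℝ) 1))) with hNB
  have hNB0 : volume NB = 0 := by
    refine measure_union_null hφnull (measure_iUnion_null fun i => ?_)
    exact volume_image_diff_iUnion_dyadic_eq_zero (φ i)
      (fun (c : Fin d → Bool) (y : Fin d → ℝ) (l : Fin d) => if c l then 1 - y l / 2 else y l / 2)
      (fun _ _ _ => rfl) fun x hx => ((hφF i).1 x (pi_Ioo_subset_pi_Icc d hx)).differentiableAt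
  set NZ : Set (Fin (d + 1) → ℝ) := (⋃ p : Fin N₀ × (Fin d → Bool), Nz p.1 p.2) ∪
    {z | Fin.init z ∈ NB} with hNZ
  have hNZ0 : volume NZ = 0 :=
    measure_union_null (measure_iUnion_null fun p => hNz0 p.1 p.2) (volume_setOf_init_mem_eq_zero hNB0)
  have hShNZ : volume (Sh '' NZ) = 0 := by
    have himg : Sh '' NZ = TSh '' NZ := Set.image_congr fun z _ => hShT z
    rw [himg]
    exact addHaar_image_eq_zero_of_differentiableOn_of_addHaar_eq_zero volume
      (fun z _ => TSh.toContinuousLinearMap.differentiableAt.differentiableWithinAt) hNZ0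
  have hnull' : volume (B \ ⋃ q : (p : Fin N₀ × (Fin d → Bool)) × Fin (Nc p.1 p.2),
      Ψ q.1.1 q.1.2 q.2 '' Set.pi Set.univ (fun _ : Fin (d + 1) => Set.Ioo (0:ℝ) 1)) = 0 := by
    refine measure_mono_null ?_ hShNZ
    rintro y ⟨hyB, hy⟩
    have hyz : y = Sh (TSh.symm y) := by rw [hShT, TSh.apply_symm_apply]
    refine ⟨TSh.symm y, ?_, hyz.symm⟩
    rw [hyz] at hyB
    have hx : Fin.init (TSh.symm y) ∈ B₀ := hinitB₀ _ hyB
    by_contra hzN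
    simp only [hNZ, Set.mem_union, Set.mem_iUnion, Set.mem_setOf_eq, not_or, not_exists] at hzN
    obtain ⟨hzN1, hzN2⟩ := hzN
    apply hzN2
    by_cases h1 : Fin.init (TSh.symm y) ∈ ⋃ i, φ i '' Set.pi Set.univ (fun _ : Fin d => Set.Ioo (0:ℝ) 1)
    · obtain ⟨i, hi⟩ := Set.mem_iUnion.1 h1
      refine Or.inr (Set.mem_iUnion.2 ⟨i, hi, fun h2 => ?_⟩)
      obtain ⟨c, hc⟩ := Set.mem_iUnion.1 h2
      rw [← hχimg] at hc
      rcases hcover i c _ hyB hc with h3 | h3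
      · apply hy
        obtain ⟨u, hu⟩ := Set.mem_iUnion.1 h3
        rw [hyz]
        exact Set.mem_iUnion.2 ⟨⟨(i, c), u⟩, hu⟩
      · exact hzN1 (i, c) h3
    · exact Or.inl ⟨hx, h1⟩
  -- ### re-indexing by `Fin N`
  set eJ := Fintype.equivFin ((p : Fin N₀ × (Fin d → Bool)) × Fin (Nc p.1 p.2)) with heJ
  refine ⟨Fintype.card ((p : Fin N₀ × (Fin d → Bool)) × Fin (Nc p.1 p.2)),
    fun q => Ψ (eJ.symm q).1.1 (eJ.symm q).1.2 (eJ.symm q).2, fun q => hΨF _ _ _, fun q => hΨB _ _ _,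
    fun q q' hne => hdisj' fun h => hne (eJ.symm.injective h), ?_, fun q j => hfactor _ _ _ j⟩
  rw [eJ.symm.surjective.iUnion_comp fun q : (p : Fin N₀ × (Fin d → Bool)) × Fin (Nc p.1 p.2) =>
    Ψ q.1.1 q.1.2 q.2 '' Set.pi Set.univ (fun _ : Fin (d + 1) => Set.Ioo (0:ℝ) 1)]
  exact hnull'

end Summit.KontsevichZagierPeriods.SymplecticScissors.CubeNashNormalFormJungPrepare

end
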